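import Summits.RiemannHypothesis.RiemannHypothesis.Theorems.IntegerScrewCensusZetaBracket

/-!
# Route `IntegerScrew` — the `ζ(2,¼)` bracket of the census manifest-certificate checks, as integer literals

The fast checker (`IntegerScrewCensusFastCheck.fastCheckB`) takes the constant `C = ζ(2,¼) = Σ_k (k+¼)^{-2}` of
`S_M = T(C)` through two naturals `CL ≤ 2^162·C ≤ CH`.  This file fixes them once for all instances: the partial sum
`RungCert.cPartial 10000` as a literal (`cPartial_10000`, kernel), the naturals `CL10000 = ⌊2^162·cLoK 10000⌋`,
`CH10000 = ⌈2^162·cHiK 10000⌉` (`IntegerScrewCensusZetaBracket.cLoK/cHiK`, width `1.0·10⁻⁸`), and the real inequalities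
`CL10000_le : CL10000 ≤ 2^162·C`, `le_CH10000 : 2^162·C ≤ CH10000`.  RH-free; nothing here bears on the truth of RH.
-/

set_option linter.dupNamespace false
set_option autoImplicit false

namespace Summit.RiemannHypothesis.RiemannHypothesis.Theorems.IntegerScrew.Manifest

open Literature.Analysis.ValidatedNumerics Literature.Analysis.ValidatedNumerics.Numerics

/-- `RungCert.cPartial 10000` (the engine's enclosure of `Σ_{k<10000} (k+¼)^{-2}`, scale `2^48`) as a literal. -/
def cP10000 : FI := ⟨4840589675044082, 4840589675054081⟩

set_option maxRecDepth 200000 in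
set_option maxHeartbeats 0 in
/-- The literal is the engine's value (kernel). -/
theorem cPartial_10000 : RungCert.cPartial 10000 = cP10000 := by
  decide +kernel

/-- `⌊2^162 · cLoK 10000⌋`. -/
def CL10000 : ℕ := 100535698838790317660882981039705946129612472496719

/-- `⌈2^162 · cHiK 10000⌉`. -/
def CH10000 : ℕ := 100535698897460977518328775235992759031911036942289

/-- `CL10000 ≤ 2^162 · cLoK 10000` in `ℚ`. -/
theorem CL10000_le_cLoK : (CL10000 : ℚ) ≤ 2 ^ 162 * cLoK 10000 := by
  rw [cLoK, cPartial_10000]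
  norm_num [cP10000, CL10000, SC]

/-- `2^162 · cHiK 10000 ≤ CH10000` in `ℚ`. -/
theorem cHiK_le_CH10000 : 2 ^ 162 * cHiK 10000 ≤ (CH10000 : ℚ) := by
  rw [cHiK, cPartial_10000]
  norm_num [cP10000, CH10000, SC]

/-- **`CL10000 ≤ 2^162 · ζ(2,¼)`.** -/
theorem CL10000_le : (CL10000 : ℝ) ≤ 2 ^ 162 * RungCert.lerchC := by
  have h1 := cLoK_le_lerchC 10000
  have h2 : ((CL10000 : ℚ) : ℝ) ≤ ((2 ^ 162 * cLoK 10000 : ℚ) : ℝ) := Rat.cast_le.2 CL10000_le_cLoK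
  push_cast at h2
  nlinarith

/-- **`2^162 · ζ(2,¼) ≤ CH10000`.** -/
theorem le_CH10000 : 2 ^ 162 * RungCert.lerchC ≤ (CH10000 : ℝ) := by
  have h1 := lerchC_le_cHiK (K := 10000) (by norm_num)
  have h2 : ((2 ^ 162 * cHiK 10000 : ℚ) : ℝ) ≤ ((CH10000 : ℚ) : ℝ) := Rat.cast_le.2 cHiK_le_CH10000
  push_cast at h2
  nlinarith

end Summit.RiemannHypothesis.RiemannHypothesis.Theorems.IntegerScrew.Manifest
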